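import Summits.RiemannHypothesis.RiemannHypothesis.Theorems.WeilFormatCDataKitCB
import HarnessLib

/-!
# Format C, design C∞: the table door's FLOORS from the format-C light table (reciprocal dyadic weights)

Route context: Fourier–Galerkin / Schur-complement certificates of Weil positivity on a window ("format C", C∞ door;
cell memo `run/shared/lean/pub/rh-explicit/rh-explicit-weil-10/KERNEL-LEVER.md` §23; supporting stmt-RiemannHypothesis-0098;
seat rh-explicit-weil-10).  `weilPositivityOn_of_cinf_table / _facts / _pipeline` take, per sector, a middle-weight
table `wtab` on `[B+1, m₀)` (resp. `[Bo, m₀o)`) with `d₀ ≤ wtab m ≤ d̂_A(m)` mode by mode (`htabe`/`htabo`), one far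
value `d₁ ≤ d̂_A(m₀)` (`hd₁e`: even; `hd₁o`: odd with the penalty `π/4`) and `0 < d₀ ≤ d₁`.  This file produces exactly
these four facts from the SAME certified objects the format-C K-rungs use (rh-explicit-weil-2's kit,
`weilPositivityOn_of_kitCB/CBM`): the light table `ctab` of per-mode records (`TabColValid`), the reciprocal dyadic
weight list `v` with `wtab = wvF v cv B` (`w(B+t) = 2^cv/v_t`, checked by `checkWeightsEvenV` / `checkWeightsOddV`
against the boxed far diagonal `devEvenBox` / `devOddABox`), one box comparison at `m₀` for `d₁ = d1z·2^{−cd}`, and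
`d₀ = 2^cv/vmax` for any bound `vmax` of the weight list:

* `cinf_floors_even` — `0 < d₀ ∧ d₀ ≤ d₁ ∧ htabe ∧ hd₁e` with the door's `d̂⁺_A = devEvenA a A (Be+1)`;
* `cinf_floors_odd` — the same with `devOddAA a A Bo` (per mode, arctan penalty) and `devOdd0A a A Bo m₀o` (`π/4`).

The conclusions are the door hypotheses up to unfolding `devEvenA / devOddAA / devOdd0A` (definitional).  Interval
plumbing only; standard axioms; no RH claim.
-/

set_option linter.dupNamespace false
set_option autoImplicit false

noncomputable section

open Complex Finset
open scoped Real BigOperators ArithmeticFunction.vonMangoldt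

namespace Summit.RiemannHypothesis.RiemannHypothesis.Theorems.WeilFormatC

open Literature.NumberTheory.LFunctions Literature.NumberTheory.LFunctions.Yoshida1992
  Literature.NumberTheory.LFunctions.Yoshida1992.Encl Literature.Analysis.SpecialFunctions
  Literature.Analysis.ValidatedNumerics.NumericsMP

variable {a : ℝ} {S : ℕ} {ks : List PrimeLen} {C : Consts} {F : FDConsts}

/-- `d₀ = 2^cv/vmax` is positive and below `d₁ = d1z·2^{−cd}` when `2^cv·2^cd ≤ vmax·d1z`. -/
theorem cinf_d0_floor {cv cd vmax d1z : ℕ} (hvmax0 : 0 < vmax) (h01 : 2 ^ cv * 2 ^ cd ≤ vmax * d1z) :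
    0 < (2 : ℝ) ^ cv / vmax ∧ (2 : ℝ) ^ cv / vmax ≤ (d1z : ℝ) * (1 / 2 ^ cd) := by
  have hv : (0 : ℝ) < vmax := by exact_mod_cast hvmax0
  refine ⟨by positivity, ?_⟩
  rw [div_le_iff₀ hv, mul_one_div, div_mul_eq_mul_div, le_div_iff₀ (by positivity)]
  have h' : (2 : ℝ) ^ cv * 2 ^ cd ≤ (vmax : ℝ) * d1z := by exact_mod_cast h01
  linarith

/-- The weight `wvF v cv B m = 2^cv/v_{m−B}` is at least `2^cv/vmax` when `0 < v_{m−B} ≤ vmax`. -/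
theorem cinf_d0_le_wvF {cv vmax B m : ℕ} {v : List ℕ} (hv : 0 < v.getD (m - B) 0) (hle : v.getD (m - B) 0 ≤ vmax) :
    (2 : ℝ) ^ cv / vmax ≤ wvF v cv B m := by
  unfold wvF
  have hv' : (0 : ℝ) < (v.getD (m - B) 0 : ℕ) := by exact_mod_cast hv
  have hle' : ((v.getD (m - B) 0 : ℕ) : ℝ) ≤ vmax := by exact_mod_cast hle
  exact div_le_div_of_nonneg_left (by positivity) hv' hle'

/-- **Even floors of the C∞ table door from the light table.**  Block modes `0..Be` (far from `Be+1`), threshold `m₀e`,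
records `ctab` valid on `[Be+1, N)` with `m₀e < N`; weights `v` checked on `[Be+1, m₀e)`; `d₁ = d1z·2^{−cd}` checked at
`m₀e`; `d₀ = 2^cv/vmax`.  Conclusion: `0 < d₀`, `d₀ ≤ d₁`, the door's `htabe` for `wtabe := wvF v cv (Be+1)`, and `hd₁e`. -/
theorem cinf_floors_even (hS : 0 < S) (ha : 0 < a) {A : ℝ} (hC : ConstsValid S a ks C) (hF : FDValidA S a A F)
    {ctab : List IdxRec} {Be m₀e N : ℕ} (hBm : Be + 1 ≤ m₀e) (hN : m₀e < N)
    (hCT : TabColValid S a ks (Be + 1) N ctab)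
    {p q : ℕ} (hsq : checkSqrtUpper 8 (Be + 1 - 1) p q = true)
    {cv : ℕ} {v : List ℕ} (hW : checkWeightsEvenV S C F ctab (Be + 1) (m₀e - (Be + 1)) cv v p q = true)
    {vmax : ℕ} (hvmax0 : 0 < vmax) (hvmax : ∀ t, t < m₀e - (Be + 1) → v.getD t 0 ≤ vmax)
    {cd d1z : ℕ} (hd1 : (d1z : ℤ) * (S : ℤ) ≤ (devEvenBox S C F (tget ctab m₀e) m₀e p q).lo * 2 ^ cd)
    (h01 : 2 ^ cv * 2 ^ cd ≤ vmax * d1z) :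
    0 < (2 : ℝ) ^ cv / vmax ∧ (2 : ℝ) ^ cv / vmax ≤ (d1z : ℝ) * (1 / 2 ^ cd) ∧
    (∀ m : ℕ, Be + 1 ≤ m → m < m₀e →
      (2 : ℝ) ^ cv / vmax ≤ wvF v cv (Be + 1) m ∧ wvF v cv (Be + 1) m ≤ devEvenA a A (Be + 1) m) ∧
    (d1z : ℝ) * (1 / 2 ^ cd) ≤ devEvenA a A (Be + 1) m₀e := by
  obtain ⟨hd0, hd01⟩ := cinf_d0_floor (cv := cv) (cd := cd) hvmax0 h01
  refine ⟨hd0, hd01, fun m hm hmm ↦ ?_, ?_⟩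
  · obtain ⟨hvpos, hvle⟩ := weightsEvenV_of_check hW (m - (Be + 1)) (by omega)
    rw [show Be + 1 + (m - (Be + 1)) = m by omega] at hvle
    have hre : MI.mem S (reDigammaQuarter (freq a m)) (tget ctab m).reP := (hCT m hm (by omega)).2
    have hlo := devEvenBox_lo_le_A hS ha hC hF hre (by omega) hsq (Be := Be + 1) (p := p) (q := q)
    have hw := wv_le_of_lo hS hvpos hvle hlo
    refine ⟨cinf_d0_le_wvF hvpos (hvmax _ (by omega)), ?_⟩
    simpa only [wvF] using hw.2
  · have hre : MI.mem S (reDigammaQuarter (freq a m₀e)) (tget ctab m₀e).reP := (hCT m₀e (by omega) hN).2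
    have hlo := devEvenBox_lo_le_A hS ha hC hF hre (by omega) hsq (Be := Be + 1) (p := p) (q := q)
    exact dyadic_le_of_lo hS hd1 hlo

/-- **Odd floors of the C∞ table door from the light table.**  Block = kernel indices `0..Bo−1` (modes `1..Bo`),
far kernel indices `k ≥ Bo` (mode `k+1`), threshold index `m₀o`; records valid at the MODES `[Bo+1, N)` with
`m₀o + 1 < N`; weights checked on `[Bo, m₀o)` against the arctan diagonal; `d₁` checked at `m₀o` against the `π/4`
diagonal; `d₀ = 2^cv/vmax`.  Conclusion: `0 < d₀`, `d₀ ≤ d₁`, the door's `htabo` for `wtabo := wvF v cv Bo`, `hd₁o`. -/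
theorem cinf_floors_odd (hS : 0 < S) (ha : 0 < a) {A : ℝ} (hC : ConstsValid S a ks C) (hF : FDValidA S a A F)
    {ctab : List IdxRec} {Bo m₀o N : ℕ} (hBo : 0 < Bo) (hBm : Bo ≤ m₀o) (hN : m₀o + 1 < N)
    (hCT : TabColValid S a ks (Bo + 1) N ctab)
    {Kser q p q' : ℕ} (hsq : checkSqrtUpper 8 Bo p q' = true)
    {cv : ℕ} {v rs : List ℕ} (hW : checkWeightsOddV S Kser C F ctab Bo (m₀o - Bo) cv v rs q p q' = true)
    {vmax : ℕ} (hvmax0 : 0 < vmax) (hvmax : ∀ t, t < m₀o - Bo → v.getD t 0 ≤ vmax)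
    {cd d1z : ℕ} (hd1 : (d1z : ℤ) * (S : ℤ) ≤ (devOddBox S C F (tget ctab (m₀o + 1)) m₀o Bo p q').lo * 2 ^ cd)
    (h01 : 2 ^ cv * 2 ^ cd ≤ vmax * d1z) :
    0 < (2 : ℝ) ^ cv / vmax ∧ (2 : ℝ) ^ cv / vmax ≤ (d1z : ℝ) * (1 / 2 ^ cd) ∧
    (∀ k : ℕ, Bo ≤ k → k < m₀o →
      (2 : ℝ) ^ cv / vmax ≤ wvF v cv Bo k ∧ wvF v cv Bo k ≤ devOddAA a A Bo k) ∧
    (d1z : ℝ) * (1 / 2 ^ cd) ≤ devOdd0A a A Bo m₀o := by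
  obtain ⟨hd0, hd01⟩ := cinf_d0_floor (cv := cv) (cd := cd) hvmax0 h01
  refine ⟨hd0, hd01, fun k hk hkm ↦ ?_, ?_⟩
  · obtain ⟨hvpos, hsqk, Y, hY, hvle⟩ := weightsOddV_of_check hW (k - Bo) (by omega)
    rw [show Bo + (k - Bo) = k by omega] at hsqk hY
    have hre : MI.mem S (reDigammaQuarter (freq a ((k : ℤ) + 1))) (tget ctab (k + 1)).reP := by
      have h := (hCT (k + 1) (by omega) (by omega)).2
      push_cast at h
      exact h
    have hlo := devOddABox_lo_le_A hS ha hC hF hre hBo hsqk hsq hY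
    have hw := wv_le_of_lo hS hvpos hvle hlo
    refine ⟨cinf_d0_le_wvF hvpos (hvmax _ (by omega)), ?_⟩
    simpa only [wvF] using hw.2
  · have hre : MI.mem S (reDigammaQuarter (freq a ((m₀o : ℤ) + 1))) (tget ctab (m₀o + 1)).reP := by
      have h := (hCT (m₀o + 1) (by omega) hN).2
      push_cast at h
      exact h
    have hlo := devOddBox_lo_le_A hS ha hC hF hre hBo hsq (l := m₀o) (p := p) (q := q')
    exact dyadic_le_of_lo hS hd1 hlo

end Summit.RiemannHypothesis.RiemannHypothesis.Theorems.WeilFormatC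

end
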